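import Summits.QuantumFields.QCD.Theses.NestedDissectionSea
import Summits.QuantumFields.QCD.Theses.HeavyThresholdYMBridge
import Summits.QuantumFields.QCD.Theses.AdaptiveBlockFermions

/-!
# Line `local-ac-open-certificate` — skeleton for the crux `NestedDissectionSea.RobustYangMills`
(item stmt-QuantumFields-13897; shared verbatim by HeavyThresholdYMBridge #2 and AdaptiveBlockFermions
#4), crux-plan round 1, planner `planner-cruxplan-stmt-QuantumFields-13897-local-ac-open-certif-0`.

**Crux (fixed, by name).** `∃ η₀ > 0, ∃ κ ≥ 0, ∀` scaling data, a.f. `SU(3)` coupling sequences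
`(β', Λ')`, block scales `ℓ₀ > 0` and families `W` admissible eventually in `k` ((h1) lattice
symmetries, (h2) RP, (h3) `‖W‖_{⌊ℓ₀/a_k⌋,κ} ≤ η₀/max(1, afBeta 0 Λ' ℓ₀)`, (h4) range control):
subsequential OS limit of all renormalised species with non-trivial non-Gaussian curvature ((i′),(ii)),
`HasMassGap Δ`, uniform lattice clustering (iii′) and Lipschitz continuity in `W` (iv). §0 names its
pieces (`AdmAt`, `ClauseConv/Cluster/Lip`, `Concl`, `budget`, `Explicit`); `robustYangMills_of_explicit`
is the definitional unfolding.

**Idea (Cruxes/RobustYangMills/Ideas/local-ac-open-certificate.md; triage r1-1 pass (U-half), r1-2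
pass, r1-3 pass).** (h3) is a sup bound at a PHYSICAL block scale, so the DLR kernels of `μ_{β',W}` on
`n`-block regions have two-sided, `k`-uniform densities `e^{±2ηn}` w.r.t. Wilson's kernels with the same
exterior (`stub_localAC`, THE LEVER, provable now). IR half: a finite-size mixing certificate for the
Wilson reference is OPEN under such perturbations. PLANNER'S REPAIR of the IR half (answering r1-1's
kill of the worst-case TV engine, "UV-toxic": coherent exterior flux `θ₀/b` per plaquette has central
Cameron–Martin norm `≍ βθ₀²b² → ∞`): the certificate is asked only for exterior data that are GOOD
(typical) on the cube and its shell, bad cells being Peierls-rare under the MEASURE (`IsGoodFS`,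
`PeierlsRare`); the engine becomes disagreement percolation with rare open defects plus a local-a.c.
bootstrap for rarity under the perturbed measure (`stub_mixingEngine`, classical, `G`-blind); the bet is
the `SU(3)` Wilson GOOD-CUBE certificate along every a.f. sequence (`stub_wilsonCertificate`, W-free,
the card's Transfer target `C⁺` in typical-boundary form); `stub_deployment` (frames, counting, `∀ᶠ`)
turns toolkit + engine + certificate into `IRConeClustering`: clause (iii′) with constants UNIFORM over
the whole (h3)∧(h4)-cone in the infrared regime `Λ'ℓ₀ ≥ c₁`, RP-free and symmetry-free — this line's
own deliverable. The renormalised-field clauses are NOT reachable by sup-norm/TV information (the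
`a_k^{-4}` renormalisation; triage r1-2 App. C): they are isolated in `stub_renormalisedLeg` ((i′),
(ii), gap, (iv) on `⁰𝒮`: `W ≡ 0` Clay core — Disproof §5 — + washing of the rigidity lines + E1 + RP
transfer matrix), CONDITIONAL on the uniform clustering this line supplies, and in the SUSPECT shared
node `stub_diagonalExtension` ((iv) on `⁰𝒮` ⇒ verbatim (iv): believed false for coincident smearings,
`3Δμ·Var ≍ δ g_k² a_k^{-4}` — the same flag as Lines/cross-plane-hankel-rigidity.lean Stub 5; a
restatement of (iv) on `⁰𝒮` makes it trivial); the ultraviolet regime `Λ'ℓ₀ < c₁` is the explicitly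
foreign `stub_uvRider` (soft-absorption line). `RobustYangMills_of` composes the seven stubs into the
crux BY NAME (regime split; constants reconciled by monotonicity, §6); `RobustYangMills_proof` (primary `HeavyThresholdYMBridge` name), `_proof_nestedDissectionSea`,
`_proof_adaptiveBlockFermions` are the unconditional forms for the three verbatim route copies.

**Disproof.lean (cdisprove, 01:21Z) honoured.** §4 `robustYangMillsNoSmall_false` ((h3) load-bearing):
(h3) enters quantitatively at `stub_deployment` (`ε₁ = 2·7⁴·η₁` against the engine's threshold) and in
toolkit (a)/(b). §0b `rangeControl_of_side_le` ((h4) does not localise large polymers): toolkit (b) uses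
the weight `e^{κ|X|}` WITH (h4), and the deployment needs `κ > 0` (`r = κ`; the composition takes
`κ = max 1 κ₄ ≥ 1`) — this also honours triage r1-2 Appendix A (the `κ = 0` instance of the crux body is
false modulo a specific-heat bound: the `κ = 0` mixture `W^mix` is sup-small yet long-range ordered;
`IRConeClustering η₁ 0 c₁` is never claimed). §5 `robustYangMills_imp_wilson` (crux ⊇ Clay `SU(3)` +
β-universality): that content sits in `stub_wilsonCertificate` (IR, gap) and `stub_renormalisedLeg`
(UV, OS existence), openly. Landed Negative lemmas `Theorems/RobustYangMills/Negative/{GlobalActivity,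
MixtureWitness}` (global one-activity witnesses `gOne/gMix`): their perturbations have sup norm `≍ β S_W`,
outside every `NormLE κ η₁` ball — no stub is an instance they refute. `-- Targets`: none yet.

**Triage answers.** r1-1 (IR half UV-toxic; re-scope to (U)): worst-case condition replaced by the
good-exterior condition + Peierls; the e^{±η}-stability the washing line wants is toolkit (a). r1-2/r1-3
(needs `κ > 0`): built in (`r = κ > 0`). r1-3 (2) ((iv) via `L²`/moment norms, not sup norms):
recorded in `stub_renormalisedLeg` (washing + BCO expansion; no interpolation in `W`; (iv) on `⁰𝒮`). r1-3 (3) (scope: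
consuming routes sit at `ℓ₀ ≪ c₁/Λ'`): `stub_uvRider` is the explicit foreign leg. r1-2/r1-3 merge with
certified-cube-openness: this skeleton IS the merged line (bounded-tilt sandwich + certificate engine).
-/

set_option autoImplicit false

noncomputable section

namespace Summit.QuantumFields.QCD.Cruxes.RobustYangMills.LocalAcOpenCertificate

open scoped BigOperators Topology ENNReal
open Filter MeasureTheory
open Literature.MathematicalPhysics.QuantumLattice Literature.MathematicalPhysics.AQFT
  Literature.MathematicalPhysics.QuantumFieldTheory
open Summit.QuantumFields.QCD.Theses.NestedDissectionSea (RobustYangMills)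

/-! ## §0 The crux's vocabulary, named -/

/-- `SU(3)`. -/
abbrev SU3 : Type := ↥(Matrix.specialUnitaryGroup (Fin 3) ℂ)

/-- The fundamental representation of `SU(3)` (the crux's `ρ`). -/
abbrev ρ₃ : SU3 →* Matrix (Fin 3) (Fin 3) ℂ := fundamentalRep (Fin 3)

/-- The crux's lattice representation data `r₃`. -/
def r₃ : LatticeRep SU3 :=
  ⟨3, ρ₃, continuous_fundamentalRep _, fundamentalRep_injective _, fundamentalRep_mem_unitaryGroup⟩

/-- A family of perturbations indexed by the level `k` and the torus half-side `S`, at block scale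
`⌊ℓ₀ / a_k⌋` (the crux's `W`). -/
abbrev Family (a : ℕ → ℝ) (ℓ₀ : ℝ) : Type :=
  (k : ℕ) → (S : ℕ) → QuasiLocalGaugePerturbation 4 (2 * S + 1) SU3 ⌊ℓ₀ / a k⌋₊

/-- **Admissibility at level `k`** — verbatim the crux's `AdmAt` with `(κ, η)` explicit:
(h1) lattice symmetries of the total, (h2) reflection positivity at `β'_k`, (h3) `NormLE κ η`,
(h4) range control, on every torus `S ≥ L_k`. -/
def AdmAt (κ η : ℝ) (a : ℕ → ℝ) (L : ℕ → ℕ) (β' : ℕ → ℝ) (ℓ₀ : ℝ) (W : Family a ℓ₀) (k : ℕ) : Prop :=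
  ∀ S : ℕ, L k ≤ S →
    (∀ (v : Site 4 (2 * S + 1)) (U : GaugeConfig 4 (2 * S + 1) SU3),
      (W k S).total (torusConfigShift v U) = (W k S).total U) ∧
    (∀ U : GaugeConfig 4 (2 * S + 1) SU3, (W k S).total (GaugeConfig.timeReflect U) = (W k S).total U) ∧
    (∀ (π : Equiv.Perm (Fin 4)) (U : GaugeConfig 4 (2 * S + 1) SU3),
      (W k S).total (fun e => U (e.1 ∘ π, π.symm e.2)) = (W k S).total U) ∧
    (W k S).IsReflectionPositive ρ₃ (β' k) ∧
    (W k S).NormLE κ η ∧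
    (∀ X : Finset (Site 4 (2 * S + 1)), X ∈ polymers ⌊ℓ₀ / a k⌋₊ →
      (∃ U : GaugeConfig 4 (2 * S + 1) SU3, (W k S).act X U ≠ 0) →
      ∀ y ∈ X, ∀ y' ∈ X, ∀ i : Fin 4,
        (y i - y' i).val ≤ ⌊ℓ₀ / a k⌋₊ * X.card ∨ (y' i - y i).val ≤ ⌊ℓ₀ / a k⌋₊ * X.card)

/-- The species scheme of the crux's data with renormalisations `(c, m)`. -/
abbrev sch (a : ℕ → ℝ) (L : ℕ → ℕ) (ha : ∀ k, 0 < a k) (ha₀ : Tendsto a atTop (𝓝 0))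
    (haL : Tendsto (fun k => a k * L k) atTop atTop) (β' : ℕ → ℝ) (c m : YMSpecies SU3 → ℕ → ℝ) :
    SpeciesScheme (YMSpecies SU3) :=
  ⟨a, ha, ha₀, β', L, haL, c, m⟩

/-- **Clause (i′)** along the subsequence `φ` with renormalisations `(c, m)` and limit `T`. -/
def ClauseConv (a : ℕ → ℝ) (L : ℕ → ℕ) (ha : ∀ k, 0 < a k) (ha₀ : Tendsto a atTop (𝓝 0))
    (haL : Tendsto (fun k => a k * L k) atTop atTop) (β' : ℕ → ℝ) (ℓ₀ : ℝ) (W : Family a ℓ₀)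
    (φ : ℕ → ℕ) (c m : YMSpecies SU3 → ℕ → ℝ) (T : OSData (YMSpecies SU3) 4) : Prop :=
  ∀ n : ℕ, n ≠ 0 → ∀ (σ : Fin n → YMSpecies SU3) (f : Fin n → SchwartzMap (EuclideanSpace ℝ (Fin 4)) ℝ)
    (F : SchwartzMap (Fin n → EuclideanSpace ℝ (Fin 4)) ℂ),
    IsTensorOf F (fun i => ofRealTest (f i)) → IsOffDiagonal F →
      Tendsto (fun j : ℕ => ((perturbedLatticeSchwinger ρ₃ (sch a L ha ha₀ haL β' c m)
        (fun k => W k (L k)) (fun s => s.F) (φ j) n σ f : ℝ) : ℂ)) atTop (𝓝 (T.schwinger n σ F))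

/-- **Clause (iii′)** at rate `Δ`: uniform lattice clustering of all species pairs on all tori
`S ≥ L_k`. -/
def ClauseCluster (a : ℕ → ℝ) (L : ℕ → ℕ) (β' : ℕ → ℝ) (ℓ₀ : ℝ) (W : Family a ℓ₀) (Δ : ℝ) : Prop :=
  ∀ A B : YMSpecies SU3, ∃ C : ℝ, ∀ᶠ k in atTop, ∀ S : ℕ, L k ≤ S → ∀ n : ℕ, n ≤ S →
    |(W k S).connectedCorr ρ₃ (β' k) A.F B.F n| ≤ C * Real.exp (-(Δ * (a k * n)))

/-- **Clause (iv)** with admissibility parameters `(κ, η)` and renormalisations `(c, m)`. -/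
def ClauseLip (κ η : ℝ) (a : ℕ → ℝ) (L : ℕ → ℕ) (ha : ∀ k, 0 < a k) (ha₀ : Tendsto a atTop (𝓝 0))
    (haL : Tendsto (fun k => a k * L k) atTop atTop) (β' : ℕ → ℝ) (ℓ₀ : ℝ) (W : Family a ℓ₀)
    (c m : YMSpecies SU3 → ℕ → ℝ) : Prop :=
  ∀ (n : ℕ) (σ : Fin n → YMSpecies SU3) (f : Fin n → SchwartzMap (EuclideanSpace ℝ (Fin 4)) ℝ),
    ∃ C : ℝ, ∀ᶠ k in atTop, ∀ W', AdmAt κ η a L β' ℓ₀ W' k → ∀ δ : ℝ, 0 ≤ δ →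
      (∀ S : ℕ, L k ≤ S → (W k S - W' k S).NormLE κ δ) →
        |perturbedLatticeSchwinger ρ₃ (sch a L ha ha₀ haL β' c m) (fun k => W k (L k)) (fun s => s.F) k n σ f -
          perturbedLatticeSchwinger ρ₃ (sch a L ha ha₀ haL β' c m) (fun k => W' k (L k)) (fun s => s.F) k n σ f|
          ≤ C * δ

/-- **Clause (iv) on `⁰𝒮`**: the Lipschitz bound for `n ≠ 0` and smearings whose tensor
`f₁ ⊗ ⋯ ⊗ fₙ` is off-diagonal (pairwise separated supports) — the part of (iv) that is believed; the
passage to ALL smearings is `DiagonalExtension` (§4, SUSPECT). Same shape as the rigidity line's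
`OffDiagLipschitz` (Lines/cross-plane-hankel-rigidity.lean). -/
def ClauseLipOff (κ η : ℝ) (a : ℕ → ℝ) (L : ℕ → ℕ) (ha : ∀ k, 0 < a k) (ha₀ : Tendsto a atTop (𝓝 0))
    (haL : Tendsto (fun k => a k * L k) atTop atTop) (β' : ℕ → ℝ) (ℓ₀ : ℝ) (W : Family a ℓ₀)
    (c m : YMSpecies SU3 → ℕ → ℝ) : Prop :=
  ∀ n : ℕ, n ≠ 0 → ∀ (σ : Fin n → YMSpecies SU3) (f : Fin n → SchwartzMap (EuclideanSpace ℝ (Fin 4)) ℝ)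
    (F : SchwartzMap (Fin n → EuclideanSpace ℝ (Fin 4)) ℂ),
    IsTensorOf F (fun i => ofRealTest (f i)) → IsOffDiagonal F →
    ∃ C : ℝ, ∀ᶠ k in atTop, ∀ W', AdmAt κ η a L β' ℓ₀ W' k → ∀ δ : ℝ, 0 ≤ δ →
      (∀ S : ℕ, L k ≤ S → (W k S - W' k S).NormLE κ δ) →
        |perturbedLatticeSchwinger ρ₃ (sch a L ha ha₀ haL β' c m) (fun k => W k (L k)) (fun s => s.F) k n σ f -
          perturbedLatticeSchwinger ρ₃ (sch a L ha ha₀ haL β' c m) (fun k => W' k (L k)) (fun s => s.F) k n σ f|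
          ≤ C * δ

/-- **The crux's conclusion for `W`** (verbatim): a subsequence, renormalisations, OS data `T` and
`Δ > 0` with (i′), non-triviality and non-Gaussianity of the curvature, `HasMassGap Δ`, (iii′) at
`Δ`, and (iv). -/
def Concl (κ η : ℝ) (a : ℕ → ℝ) (L : ℕ → ℕ) (ha : ∀ k, 0 < a k) (ha₀ : Tendsto a atTop (𝓝 0))
    (haL : Tendsto (fun k => a k * L k) atTop atTop) (β' : ℕ → ℝ) (ℓ₀ : ℝ) (W : Family a ℓ₀) : Prop :=
  ∃ φ : ℕ → ℕ, StrictMono φ ∧ ∃ (c m : YMSpecies SU3 → ℕ → ℝ) (T : OSData (YMSpecies SU3) 4) (Δ : ℝ),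
    0 < Δ ∧ ClauseConv a L ha ha₀ haL β' ℓ₀ W φ c m T ∧ T.IsNontrivial r₃.curvature ∧
      T.IsNonGaussian r₃.curvature ∧ T.HasMassGap Δ ∧ ClauseCluster a L β' ℓ₀ W Δ ∧
      ClauseLip κ η a L ha ha₀ haL β' ℓ₀ W c m

/-- The budget of the crux at block scale `ℓ₀`: `η = η₀ / max 1 (afBeta 0 Λ' ℓ₀)`. -/
def budget (η₀ Λ' ℓ₀ : ℝ) : ℝ := η₀ / max 1 (afBeta 0 Λ' ℓ₀)

/-- **The crux in named form.** -/
def Explicit (η₀ κ : ℝ) : Prop :=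
  ∀ (a : ℕ → ℝ) (L : ℕ → ℕ) (ha : ∀ k, 0 < a k) (ha₀ : Tendsto a atTop (𝓝 0))
    (haL : Tendsto (fun k => a k * L k) atTop atTop) (β' : ℕ → ℝ) (Λ' : ℝ), 0 < Λ' →
    Tendsto (fun k => β' k - afBeta 0 Λ' (a k)) atTop (𝓝 0) → ∀ ℓ₀ : ℝ, 0 < ℓ₀ →
    ∀ W : Family a ℓ₀, (∀ᶠ k in atTop, AdmAt κ (budget η₀ Λ' ℓ₀) a L β' ℓ₀ W k) →
      Concl κ (budget η₀ Λ' ℓ₀) a L ha ha₀ haL β' ℓ₀ W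

/-- The named form is the crux (definitional unfolding). -/
theorem robustYangMills_of_explicit {η₀ κ : ℝ} (hη₀ : 0 < η₀) (hκ : 0 ≤ κ) (h : Explicit η₀ κ) :
    RobustYangMills := by
  refine ⟨η₀, hη₀, κ, hκ, ?_⟩
  intro a L ha ha₀ haL β' Λ' hΛ' hβ' ℓ₀ hℓ₀ η hAdm W hW
  exact h a L ha ha₀ haL β' Λ' hΛ' hβ' ℓ₀ hℓ₀ W hW


/-! ## §1 The perturbed torus specification and the local-absolute-continuity toolkit (stub A) -/

section Spec

open Literature.Probability.LatticeModels (Specification IsSpecification IsGibbsMeasure glueWith)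

variable {G : Type} [Group G] [TopologicalSpace G] [IsTopologicalGroup G] [CompactSpace G]
  [MeasurableSpace G] [BorelSpace G]

/-- **The perturbed torus specification** `γ^{β,W}_Λ(· | ζ)`: product Haar on the edges of `Λ`,
glued with the exterior datum `ζ` off `Λ`, tilted by `-β S_W - W.total` (terms not touching `Λ`
are constant in the glued variables and cancel in the normalisation). At `W = 0` this is Wilson's
torus specification; its kernels are the DLR conditional laws of `W.perturbedMeasure ρ β`
(part (c) of the toolkit). -/
def spec {N Lt : ℕ} [NeZero Lt] {b : ℕ} (ρ : G →* Matrix (Fin N) (Fin N) ℂ) (β : ℝ)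
    (W : QuasiLocalGaugePerturbation 4 Lt G b) : Specification (Edge 4 Lt) G :=
  fun Λ ζ => ((Measure.pi fun _ : ↥Λ => haarProbability G).map (glueWith Λ · ζ)).tilted
    fun U => -β * wilsonAction ρ U - W.total U

/-- **Wilson's torus specification** = the perturbed one at `W = 0` (block scale immaterial, `1`). -/
abbrev wilsonSpec {N Lt : ℕ} [NeZero Lt] (ρ : G →* Matrix (Fin N) (Fin N) ℂ) (β : ℝ) :
    Specification (Edge 4 Lt) G :=
  spec ρ β (0 : QuasiLocalGaugePerturbation 4 Lt G 1)

/-- **Range control (h4)** of one perturbation at block scale `b` (verbatim the crux's clause): a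
polymer with a non-vanishing activity has coordinate extent at most `b · |X|`. -/
def RangeControl {Lt : ℕ} [NeZero Lt] {b : ℕ} (W : QuasiLocalGaugePerturbation 4 Lt G b) : Prop :=
  ∀ X : Finset (Site 4 Lt), X ∈ polymers b → (∃ U : GaugeConfig 4 Lt G, W.act X U ≠ 0) →
    ∀ y ∈ X, ∀ y' ∈ X, ∀ i : Fin 4, (y i - y' i).val ≤ b * X.card ∨ (y' i - y i).val ≤ b * X.card

/-- The block corner `y'` is **`M` blocks near** the set of corners `R` in the sense of (h4): some
`y ∈ R` has every coordinate within `b·M` of `y'` (one way round the torus or the other). -/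
def NearBlocks {Lt : ℕ} (b : ℕ) (R : Finset (Site 4 Lt)) (M : ℕ) (y' : Site 4 Lt) : Prop :=
  ∃ y ∈ R, ∀ i : Fin 4, (y i - y' i).val ≤ b * M ∨ (y' i - y i).val ≤ b * M

/-- **(a) TV/density continuity of the kernels in `W`** (the conditional-expectation sandwich of
the idea card, two-sided and multiplicative): if `‖W - W'‖_{b,κ} ≤ δ` with `κ ≥ 0` then on every
region `Λ` made of links of the blocks `R`, for every exterior datum and every measurable
`f ∈ [0,1]`, the `W`- and `W'`-kernel expectations are within the factor `e^{2δ|R|}` of each other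
(only polymers through `R` see the glued variables, and their sup norms sum to `≤ δ` per block;
ratio of integrals). Uniform in the torus, the block size, `β`, the exterior and `f`. -/
def KernelACInW : Prop :=
  ∀ (G : Type) [Group G] [TopologicalSpace G] [IsTopologicalGroup G] [CompactSpace G]
    [MeasurableSpace G] [BorelSpace G] [SecondCountableTopology G] [MeasurableSingletonClass G]
    (N : ℕ) (ρ : G →* Matrix (Fin N) (Fin N) ℂ), Continuous ρ →
    ∀ (Lt : ℕ) [NeZero Lt] (b : ℕ) (β : ℝ) (W W' : QuasiLocalGaugePerturbation 4 Lt G b) (κ δ : ℝ),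
      0 ≤ κ → (W - W').NormLE κ δ →
      ∀ R : Finset (Site 4 Lt), R ⊆ blockCorners b →
      ∀ Λ : Finset (Edge 4 Lt), (∀ e ∈ Λ, blockCorner b e.1 ∈ R) →
      ∀ (ζ : GaugeConfig 4 Lt G) (f : GaugeConfig 4 Lt G → ℝ), Measurable f → (∀ U, 0 ≤ f U ∧ f U ≤ 1) →
        ∫ U, f U ∂(spec ρ β W Λ ζ) ≤ Real.exp (2 * δ * R.card) * ∫ U, f U ∂(spec ρ β W' Λ ζ) ∧
        ∫ U, f U ∂(spec ρ β W' Λ ζ) ≤ Real.exp (2 * δ * R.card) * ∫ U, f U ∂(spec ρ β W Λ ζ)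

/-- **(b) Quasi-locality of the kernels** (the leak term, from (h3) with `κ ≥ 0` AND (h4) — triage
r1-3 (1), Disproof §0b: (h4) alone does not localise large polymers, the weight `e^{κ|X|}` does):
if two exterior data agree on every link whose block is `(m+1)`-near `R`, the kernel expectations on
a region of links of `R` differ by the factor `exp(4η e^{-κ m}|R|)` at most — polymers through `R`
reaching a far block have `≥ m+2` blocks by (h4) and total weight `≤ η e^{-κ(m+2)}` per block of `R`;
the Wilson term is nearest-neighbour (`b ≥ 1`). At `W = 0` the factor is `1` (Markov property).
RESHAPED by the lead (2026-08-16): `f` may depend only on the links of `Λ` and on links where the two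
exterior data agree (as first typed, with `f` unrestricted, the indicator of a far exterior link value
refutes it: LHS `1`, RHS `0`, by properness); and `[MeasurableSingletonClass G]` is assumed in (a)–(c)
(for a non-T₁ compact group the product σ-algebra is trivial and properness of the kernels fails). -/
def KernelQuasiLocality : Prop :=
  ∀ (G : Type) [Group G] [TopologicalSpace G] [IsTopologicalGroup G] [CompactSpace G]
    [MeasurableSpace G] [BorelSpace G] [SecondCountableTopology G] [MeasurableSingletonClass G]
    (N : ℕ) (ρ : G →* Matrix (Fin N) (Fin N) ℂ), Continuous ρ →
    ∀ (Lt : ℕ) [NeZero Lt] (b : ℕ) (β : ℝ) (W : QuasiLocalGaugePerturbation 4 Lt G b) (κ η : ℝ),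
      1 ≤ b → 0 ≤ κ → W.NormLE κ η → RangeControl W →
      ∀ R : Finset (Site 4 Lt), R ⊆ blockCorners b →
      ∀ Λ : Finset (Edge 4 Lt), (∀ e ∈ Λ, blockCorner b e.1 ∈ R) →
      ∀ (m : ℕ) (ζ ζ' : GaugeConfig 4 Lt G),
        (∀ e : Edge 4 Lt, NearBlocks b R (m + 1) (blockCorner b e.1) → ζ e = ζ' e) →
      ∀ f : GaugeConfig 4 Lt G → ℝ, Measurable f → (∀ U, 0 ≤ f U ∧ f U ≤ 1) →
        DependsOn f {e : Edge 4 Lt | e ∈ Λ ∨ ζ e = ζ' e} →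
        ∫ U, f U ∂(spec ρ β W Λ ζ) ≤
          Real.exp (4 * (η * Real.exp (-(κ * m))) * R.card) * ∫ U, f U ∂(spec ρ β W Λ ζ')

/-- **(c) DLR**: the perturbed kernels form a specification in Georgii's sense and the perturbed
torus measure `μ_{β,W}` is a Gibbs measure for it (finite-dimensional measure theory: tilted
glued product Haar; consistency of tiltings; at `W = 0`, `wilsonMeasure`). -/
def KernelDLR : Prop :=
  ∀ (G : Type) [Group G] [TopologicalSpace G] [IsTopologicalGroup G] [CompactSpace G]
    [MeasurableSpace G] [BorelSpace G] [SecondCountableTopology G] [MeasurableSingletonClass G]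
    (N : ℕ) (ρ : G →* Matrix (Fin N) (Fin N) ℂ), Continuous ρ →
    ∀ (Lt : ℕ) [NeZero Lt] (b : ℕ) (β : ℝ) (W : QuasiLocalGaugePerturbation 4 Lt G b),
      IsSpecification (spec ρ β W) ∧ IsGibbsMeasure (spec ρ β W) (W.perturbedMeasure ρ β)

/-- **The local-absolute-continuity toolkit** (statement of `stub_localAC`): (a) ∧ (b) ∧ (c). -/
def LocalACToolkit : Prop :=
  KernelACInW ∧ KernelQuasiLocality ∧ KernelDLR

end Spec

/-! ## §2 Cells on the torus and the perturbed-mixing engine (stub B) -/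

section Cells

/-- **Coarse index** (cell labels): the discrete 4-torus `∏ᵢ ℤ/(μᵢ+1)`. -/
abbrev CoarseIdx (μ : Fin 4 → ℕ) : Type := (i : Fin 4) → ZMod (μ i + 1)

/-- `ℓ^∞` cyclic distance on the coarse torus. -/
def cdist {μ : Fin 4 → ℕ} (x y : CoarseIdx μ) : ℕ :=
  Finset.univ.sup fun i : Fin 4 => ((x i - y i).valMinAbs).natAbs

/-- **Cyclic frame** of scale `b` on `ℤ/N`: a label map stepping by `0` or `1` whose fibres are cyclic
intervals of length in `[b, 2b]` (odd / prime torus sides force unequal cells). -/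
def IsTorusFrame (N b : ℕ) {m : ℕ} (q : ZMod N → ZMod m) : Prop :=
  (∀ x : ZMod N, q (x + 1) = q x ∨ q (x + 1) = q x + 1) ∧
    ∀ c : ZMod m, ∃ (a : ZMod N) (ℓ : ℕ), b ≤ ℓ ∧ ℓ ≤ 2 * b ∧
      ∀ x : ZMod N, q x = c ↔ ∃ j : ℕ, j < ℓ ∧ x = a + j

variable {N : ℕ} {μ : Fin 4 → ℕ}

/-- Cell label of a torus site: apply the axis frames coordinatewise. -/
def siteCell (q : (i : Fin 4) → ZMod N → ZMod (μ i + 1)) (x : Site 4 N) : CoarseIdx μ :=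
  fun i => q i (x i)

/-- Cell label of a torus edge = label of its base point. -/
def cellOf (q : (i : Fin 4) → ZMod N → ZMod (μ i + 1)) (e : Edge 4 N) : CoarseIdx μ :=
  siteCell q e.1

end Cells

section Engine

open Literature.Probability.LatticeModels (Specification IsSpecification IsGibbsMeasure)

variable {V S : Type} [MeasurableSpace S] {μ : Fin 4 → ℕ}

/-- `(4n+3)⁴ − (4n+1)⁴`, the number of shell cells around the cube of `(4n+1)⁴` cells. -/
def shellCount (n : ℕ) : ℕ := (4 * n + 3) ^ 4 - (4 * n + 1) ^ 4

/-- The number of cells met by the finite set `A` of sites/links. -/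
def cellCount [Fintype V] (cell : V → CoarseIdx μ) (A : Finset V) : ℕ :=
  (Finset.univ.filter fun c : CoarseIdx μ => ∃ v ∈ A, cell v = c).card

/-- **GOOD-EXTERIOR finite-size condition in total variation** (the certificate format of this
line; the planner's repair of the card's worst-case condition, answering triage r1-1): `good c` is a
cell-local measurable set of configurations ("no atypically strong coherent field in cell `c`"), and
for every cell-union `A` inside the cube of `(4n+1)⁴` cells centred at `c`, every two exterior data
that AGREE ON THE CUBE and are GOOD on the cube-and-shell cells outside `A`, and every `[0,1]`-valued
measurable `f` of the central cell, the kernel expectations differ by at most `ε`. (With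
`good ≡ univ` this is OneCertifiedCube's worst-case condition, which is UV-toxic along `a_k → 0`.) -/
structure IsGoodFS [Fintype V] (cell : V → CoarseIdx μ) (γ : Specification V S)
    (good : CoarseIdx μ → Set (V → S)) (n : ℕ) (ε : ℝ) : Prop where
  good_local : ∀ (c : CoarseIdx μ) (σ τ : V → S), (∀ v, cell v = c → σ v = τ v) →
    (σ ∈ good c ↔ τ ∈ good c)
  good_meas : ∀ c, MeasurableSet (good c)
  fs : ∀ (c : CoarseIdx μ) (A : Finset V), (∀ v ∈ A, cdist c (cell v) ≤ 2 * n) →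
    (∀ v w, cell v = cell w → v ∈ A → w ∈ A) →
    ∀ ζ ζ' : V → S, (∀ v, cdist c (cell v) ≤ 2 * n → ζ v = ζ' v) →
      (∀ c', cdist c c' ≤ 2 * n + 1 → (∀ v, cell v = c' → v ∉ A) → ζ ∈ good c' ∧ ζ' ∈ good c') →
      ∀ f : (V → S) → ℝ, Measurable f → (∀ σ, 0 ≤ f σ ∧ f σ ≤ 1) → DependsOn f {v | cell v = c} →
        |∫ σ, f σ ∂(γ A ζ) - ∫ σ, f σ ∂(γ A ζ')| ≤ ε

/-- **Quasi-locality (leak) profile** of a specification at window `n`: exterior changes at cell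
distance `> 2n+1+D` from the centre move central-cell expectations of cube kernels by at most
`Λl e^{-rD}` (for a cell-scale Markov specification, `Λl = 0`). -/
def HasLeak [Fintype V] (cell : V → CoarseIdx μ) (γ : Specification V S) (n : ℕ) (Λl r : ℝ) : Prop :=
  ∀ (c : CoarseIdx μ) (A : Finset V), (∀ v ∈ A, cdist c (cell v) ≤ 2 * n) →
    (∀ v w, cell v = cell w → v ∈ A → w ∈ A) →
    ∀ (D : ℕ) (ζ ζ' : V → S), (∀ v, cdist c (cell v) ≤ 2 * n + 1 + D → ζ v = ζ' v) →
      ∀ f : (V → S) → ℝ, Measurable f → (∀ σ, 0 ≤ f σ ∧ f σ ≤ 1) → DependsOn f {v | cell v = c} →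
        |∫ σ, f σ ∂(γ A ζ) - ∫ σ, f σ ∂(γ A ζ')| ≤ Λl * Real.exp (-(r * D))

/-- **Local absolute continuity of `γ` with respect to `γ₀` at rate `ε₁` per cell**: on every
cell-union `A`, with the same exterior, kernel expectations of `[0,1]`-valued measurable functions
agree up to the factor `exp(ε₁ · #cells(A))`, both ways (the abstract form of toolkit (a)). -/
def IsLocallyAC [Fintype V] (cell : V → CoarseIdx μ) (γ γ₀ : Specification V S) (ε₁ : ℝ) : Prop :=
  ∀ (A : Finset V), (∀ v w, cell v = cell w → v ∈ A → w ∈ A) → ∀ (ζ : V → S) (f : (V → S) → ℝ),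
    Measurable f → (∀ σ, 0 ≤ f σ ∧ f σ ≤ 1) →
      ∫ σ, f σ ∂(γ A ζ) ≤ Real.exp (ε₁ * cellCount cell A) * ∫ σ, f σ ∂(γ₀ A ζ) ∧
      ∫ σ, f σ ∂(γ₀ A ζ) ≤ Real.exp (ε₁ * cellCount cell A) * ∫ σ, f σ ∂(γ A ζ)

/-- **Peierls rarity of bad cells** under the measure `ν`: `ν(all cells of D bad) ≤ p^{|D|}`. -/
def PeierlsRare (good : CoarseIdx μ → Set (V → S)) (ν : Measure (V → S)) (p : ℝ) : Prop :=
  ∀ D : Finset (CoarseIdx μ), ν {σ | ∀ c ∈ D, σ ∉ good c} ≤ ENNReal.ofReal (p ^ D.card)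

/-- **The perturbed-mixing engine** (statement of `stub_mixingEngine`; classical probability,
`G`-blind): for every window `n` there are thresholds `p₀(n), ε₁(n) > 0` (bad-cell rarity, local-a.c.
rate — independent of everything else, the slack convention being `2ε₀·shellCount n ≤ 1`), and for
every good-exterior threshold `ε₀` within that slack and leak rate `r > 0` a leak-amplitude threshold
`Λ₀ > 0` and constants `κₑ > 0`, `C₀` such that: on every coarse 4-torus with `≥ 4n+3` cells per
axis, for a REFERENCE specification `γ₀` satisfying the good-exterior finite-size condition and the
leak profile, whose Gibbs measure `ν₀` has Peierls-rare bad cells (`p ≤ p₀`), and a PERTURBED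
specification `γ`, locally absolutely continuous w.r.t. `γ₀` at rate `ε₁` per cell and with the same
leak profile, EVERY Gibbs measure `ν` of `γ` has exponentially decaying covariances of bounded
cell-local observables,
`|ν(fg) − ν(f)ν(g)| ≤ C₀ B_f B_g |Δf| |Δg| e^{-κₑ D}`, `D` the cell distance of the supports. -/
def PerturbedMixingEngine : Prop :=
  ∀ n : ℕ, 1 ≤ n → ∃ p₀ ε₁ : ℝ, 0 < p₀ ∧ 0 < ε₁ ∧
    ∀ (ε₀ r : ℝ), 0 ≤ ε₀ → 2 * ε₀ * (shellCount n : ℝ) ≤ 1 → 0 < r →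
    ∃ Λ₀ κₑ C₀ : ℝ, 0 < Λ₀ ∧ 0 < κₑ ∧ 0 ≤ C₀ ∧
    ∀ (μc : Fin 4 → ℕ) (V S : Type) [Fintype V] [MeasurableSpace S] (cell : V → CoarseIdx μc)
      (γ₀ γ : Specification V S) (good : CoarseIdx μc → Set (V → S)) (ν₀ ν : Measure (V → S))
      (p Λl : ℝ),
      (∀ i, 4 * n + 3 ≤ μc i + 1) → IsSpecification γ₀ → IsSpecification γ →
      IsGibbsMeasure γ₀ ν₀ → IsGibbsMeasure γ ν →
      IsGoodFS cell γ₀ good n ε₀ → 0 ≤ Λl → Λl ≤ Λ₀ → HasLeak cell γ₀ n Λl r → HasLeak cell γ n Λl r →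
      IsLocallyAC cell γ γ₀ ε₁ → 0 ≤ p → p ≤ p₀ → PeierlsRare good ν₀ p →
      ∀ (f g : (V → S) → ℝ) (Δf Δg : Finset (CoarseIdx μc)) (Bf Bg : ℝ) (D : ℕ),
        Measurable f → Measurable g → (∀ σ, |f σ| ≤ Bf) → (∀ σ, |g σ| ≤ Bg) →
        DependsOn f {v | cell v ∈ Δf} → DependsOn g {v | cell v ∈ Δg} →
        (∀ x ∈ Δf, ∀ y ∈ Δg, D ≤ cdist x y) →
          |∫ σ, f σ * g σ ∂ν - (∫ σ, f σ ∂ν) * ∫ σ, g σ ∂ν| ≤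
            C₀ * Bf * Bg * Δf.card * Δg.card * Real.exp (-(κₑ * D))

end Engine


/-! ## §3 The Wilson good-cube certificate (stub C), IR clustering of the cone, deployment (stub D) -/

section Certificate

open Literature.Probability.LatticeModels (Specification IsSpecification IsGibbsMeasure)

/-- **The SU(3) Wilson GOOD-CUBE CERTIFICATE along asymptotically free sequences** (statement of
`stub_wilsonCertificate`; the line's Transfer target `C⁺`, W-free; YM-hard — THE BET): there is a
window `n ≥ 1` (universal for `SU(3)`/Wilson/fundamental) such that for every target rarity `p > 0`
there are a threshold `ε₀` with `2ε₀ · shellCount n ≤ 1` and a physical scale `c₁ = c₁(p) > 0`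
(rarer bad cells = a stricter notion of "typical field", paid for by a larger certified cube, since the
influence of a `K`-sigma-typical exterior decays like `K e^{-m·2nℓ}`) such that for every scaling
sequence `a_k → 0`, every `N_f = 0` two-loop a.f. coupling sequence `β'` with Λ-parameter `Λ'`, and
every cell scale `C/Λ' ≥ c₁/Λ'`: eventually in `k`, on EVERY odd torus `2S+1` and for EVERY family of
axis frames of scale `⌈C/(Λ' a_k)⌉` with `≥ 4n+3` cells per axis, there is a cell-local measurable
family of GOOD sets for which Wilson's torus kernels at `β'_k` satisfy the good-exterior TV
finite-size condition `(n, ε₀)` and bad cells are Peierls-rare with ratio `p` under Wilson's torus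
measure. (Physics: at scales `≳ 5/m` the massive theory screens boundary influences of TYPICAL
amplitude exponentially in the number of cells; atypically strong coherent fields — the only toxic
exterior data — are moderate/large deviations, rare and asymptotically independent across cells.) -/
def WilsonGoodCertificate : Prop :=
  ∃ n : ℕ, 1 ≤ n ∧ ∀ p : ℝ, 0 < p → ∃ ε₀ c₁ : ℝ, 0 ≤ ε₀ ∧ 2 * ε₀ * (shellCount n : ℝ) ≤ 1 ∧ 0 < c₁ ∧
    ∀ (a : ℕ → ℝ), (∀ k, 0 < a k) → Tendsto a atTop (𝓝 0) →
    ∀ (β' : ℕ → ℝ) (Λ' : ℝ), 0 < Λ' → Tendsto (fun k => β' k - afBeta 0 Λ' (a k)) atTop (𝓝 0) →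
    ∀ C : ℝ, c₁ ≤ C →
    ∀ᶠ k in atTop, ∀ (S : ℕ) (μc : Fin 4 → ℕ) (q : (i : Fin 4) → ZMod (2 * S + 1) → ZMod (μc i + 1)),
      (∀ i, 4 * n + 3 ≤ μc i + 1) → (∀ i, IsTorusFrame (2 * S + 1) ⌈C / (Λ' * a k)⌉₊ (q i)) →
      ∃ good : CoarseIdx μc → Set (GaugeConfig 4 (2 * S + 1) SU3),
        IsGoodFS (cellOf q) (wilsonSpec (Lt := 2 * S + 1) ρ₃ (β' k)) good n ε₀ ∧
        PeierlsRare good (wilsonMeasure (d := 4) (L := 2 * S + 1) ρ₃ (β' k)) p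

/-- **Uniform IR clustering of the whole sup-small, range-controlled cone** (the line's own
deliverable; RP-free and symmetry-free): with budget `η₁` and decay rate `κ`, for all scaling data
(`a_k → 0`, `a_k L_k → ∞`), every a.f. sequence `(β', Λ')` and every block scale in the INFRARED
REGIME `Λ' ℓ₀ ≥ c₁` there is `Δ > 0` such that for every pair of species there is `C` with: for all
large `k`, on every torus `S ≥ L_k`, for EVERY perturbation `w` at block scale `⌊ℓ₀/a_k⌋` with
`‖w‖_{κ} ≤ η₁` and range control, `|⟨A; τ_t B⟩_{β'_k, w}| ≤ C e^{-Δ a_k t}` for `t ≤ S` — constants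
uniform over the cone. -/
def IRConeClustering (η₁ κ c₁ : ℝ) : Prop :=
  ∀ (a : ℕ → ℝ) (L : ℕ → ℕ), (∀ k, 0 < a k) → Tendsto a atTop (𝓝 0) →
    Tendsto (fun k => a k * L k) atTop atTop →
  ∀ (β' : ℕ → ℝ) (Λ' : ℝ), 0 < Λ' → Tendsto (fun k => β' k - afBeta 0 Λ' (a k)) atTop (𝓝 0) →
  ∀ ℓ₀ : ℝ, c₁ ≤ Λ' * ℓ₀ →
    ∃ Δ : ℝ, 0 < Δ ∧ ∀ A B : YMSpecies SU3, ∃ C : ℝ, ∀ᶠ k in atTop, ∀ S : ℕ, L k ≤ S →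
      ∀ w : QuasiLocalGaugePerturbation 4 (2 * S + 1) SU3 ⌊ℓ₀ / a k⌋₊,
        w.NormLE κ η₁ → RangeControl w → ∀ t : ℕ, t ≤ S →
          |w.connectedCorr ρ₃ (β' k) A.F B.F t| ≤ C * Real.exp (-(Δ * (a k * t)))

/-- **Deployment on the symmetric torus** (statement of `stub_deployment`; provable now modulo its
three inputs, size M/L; frames + counting + `∀ᶠ` bookkeeping): the toolkit, the engine and the
certificate give uniform IR clustering of the cone, for EVERY decay rate `κ > 0`, with a budget
`η₁(κ) > 0` and the certificate's scale `c₁`. Sketch: in the IR regime take cells of scale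
`C = 2Λ'ℓ₀ ≥ c₁` (so `⌈2ℓ₀/a_k⌉ ≥ 2⌊ℓ₀/a_k⌋`: every cell meets `≤ 7⁴` blocks and every block `≤ 2⁴`
cells); frames with `≥ 4n+3` cells per axis exist on `ℤ/(2S+1)` as soon as `(4n+3)·2⌈2ℓ₀/a_k⌉ ≤ 2L_k+1`
(eventually, `a_k L_k → ∞`); toolkit (a) gives `IsLocallyAC` of `spec W` w.r.t. `spec 0` at rate
`ε₁ = 2·7⁴·η₁`; toolkit (b) gives the leak profile `Λl = e^{4·(4n+1)⁴7⁴η₁} − 1`, `r = κ` for `spec W`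
and `0` for `spec 0`; toolkit (c) gives the DLR inputs; the certificate (rarity `p := p₀`) gives good
sets, the good-exterior condition and Peierls under `wilsonMeasure = perturbedMeasure 0`; the engine
gives covariance decay in the cell distance; species supports sit in `≤ 2⁴` cells once
`⌈2ℓ₀/a_k⌉ >` their diameter, `τ_t` moves them `≥ t/(2·2⌈2ℓ₀/a_k⌉) − 2` cells (`t ≤ S`: no wrap), and
`⌈2ℓ₀/a_k⌉ ≤ 3ℓ₀/a_k` eventually, whence `Δ = κₑ/(12 ℓ₀)`. -/
def Deployment : Prop :=
  LocalACToolkit → PerturbedMixingEngine → WilsonGoodCertificate →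
    ∃ c₁ : ℝ, 0 < c₁ ∧ ∀ κ : ℝ, 0 < κ → ∃ η₁ : ℝ, 0 < η₁ ∧ IRConeClustering η₁ κ c₁

end Certificate

/-! ## §4 The renormalised-field leg (stub E), the diagonal extension (stub F, SUSPECT), the
ultraviolet regime (stub G) -/

section Legs

/-- **Renormalised-field leg on `⁰𝒮`** (statement of `stub_renormalisedLeg`; NOT this line's mechanism —
it carries the `W ≡ 0` Clay core (Disproof §5: the crux implies OS existence + gap for pure `SU(3)`
Wilson along every a.f. sequence), the WASHING/rigidity input of the companion lines (admissible `W`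
have per-site diluted response, so the `a_k^{-4}`-renormalised species of `μ_{β',W}` are asymptotically
those of Wilson at a shifted a.f. coupling; triage r1-2 App. C, r1-3 on axis-markov-response), FULL
EUCLIDEAN INVARIANCE E1 of the limit (OPEN for cone members; `OSData` bundles E1), the gap transfer
(odd-torus RP transfer matrix from (h2) + clustering with constants UNIFORM over the cone ⇒ spectral gap
⇒ `HasMassGap` via E0′ — OneCertifiedCube.GapToContinuum, stmt-8896, whose pair-dependent-constant
caveat is answered by the uniformity of `IRConeClustering`) and the Lipschitz response ON `⁰𝒮` (polymer
expansion of `e^{-(W'-W)}`, KP-small by `NormLE κ δ`, around the clustering measure `μ_{β',W}` — BCO-type,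
no interpolation in `W` since the RP cone is not star-shaped — plus washing of admissible differences):
given uniform IR clustering of the cone at `(η₁, κ, c₁)` there is a budget `η₂ ≤ η₁` such that every
family admissible with `(κ, η ≤ η₂)` in the IR regime has a subsequential OS limit of all renormalised
species with non-trivial non-Gaussian curvature ((i′), (ii)), a mass gap, and clause (iv) on `⁰𝒮`. -/
def RenormalisedLeg : Prop :=
  ∀ (η₁ κ c₁ : ℝ), 0 < η₁ → 0 < κ → 0 < c₁ → IRConeClustering η₁ κ c₁ →
    ∃ η₂ : ℝ, 0 < η₂ ∧ η₂ ≤ η₁ ∧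
    ∀ (a : ℕ → ℝ) (L : ℕ → ℕ) (ha : ∀ k, 0 < a k) (ha₀ : Tendsto a atTop (𝓝 0))
      (haL : Tendsto (fun k => a k * L k) atTop atTop) (β' : ℕ → ℝ) (Λ' : ℝ), 0 < Λ' →
      Tendsto (fun k => β' k - afBeta 0 Λ' (a k)) atTop (𝓝 0) →
    ∀ ℓ₀ : ℝ, c₁ ≤ Λ' * ℓ₀ → ∀ η : ℝ, 0 ≤ η → η ≤ η₂ →
    ∀ W : Family a ℓ₀, (∀ᶠ k in atTop, AdmAt κ η a L β' ℓ₀ W k) →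
      ∃ φ : ℕ → ℕ, StrictMono φ ∧ ∃ (c m : YMSpecies SU3 → ℕ → ℝ) (T : OSData (YMSpecies SU3) 4),
        ClauseConv a L ha ha₀ haL β' ℓ₀ W φ c m T ∧ T.IsNontrivial r₃.curvature ∧
          T.IsNonGaussian r₃.curvature ∧ (∃ Δ' : ℝ, 0 < Δ' ∧ T.HasMassGap Δ') ∧
          ClauseLipOff κ η a L ha ha₀ haL β' ℓ₀ W c m

/-- **Diagonal extension of the response bound** (statement of `stub_diagonalExtension`) — SUSPECT:
this stub isolates the clause-(iv) defect of the crux (rev 4) and gives it a name (the same node is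
`DiagonalExtension` in Lines/cross-plane-hankel-rigidity.lean; every line inherits it). For every `(κ, η)`,
all a.f. data, every eventually admissible family `W`, every witness `(φ, c, m, T)` of (i′) with
non-trivial curvature and every uniform clustering rate: clause (iv) on `⁰𝒮` implies the verbatim
clause (iv) (all `n`, incl. `n = 0`, and COINCIDENT smearings). WHY SUSPECT: for `n = 3`, `σ ≡`
curvature, `f₁ = f₂ = f₃ = f`, `W` admissible and `W'` the admissible KP-`δ` coupling-shift direction,
`⟨Φ(f)³⟩_{W'} − ⟨Φ(f)³⟩_W ∋ 3·Δμ·Var Φ(f)` with `Δμ ≍ δ g_k²` (specific heat `∂_β⟨s⟩ ≍ g⁴ > 0`,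
dilution `a_k⁴/ℓ₀⁴` against `c_k ≍ a_k^{-4}g_k^{-2}`) and `Var Φ(f) ≍ a_k^{-4}` (forced by non-triviality
of the limit two-point function): `≍ δ g_k² a_k^{-4}`, unbounded in `k`. Repairs that make the stub TRUE
and keep the line: restrict (iv) to `⁰𝒮` smearings (as (i′) already is) or to truncated functions — a
tenure/cdisprove matter, not this line's. Do not staff before (iv) is restated or the flag refuted. -/
def DiagonalExtension : Prop :=
  ∀ (κ η : ℝ) (a : ℕ → ℝ) (L : ℕ → ℕ) (ha : ∀ k, 0 < a k) (ha₀ : Tendsto a atTop (𝓝 0))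
    (haL : Tendsto (fun k => a k * L k) atTop atTop) (β' : ℕ → ℝ) (Λ' : ℝ), 0 < Λ' →
    Tendsto (fun k => β' k - afBeta 0 Λ' (a k)) atTop (𝓝 0) →
    ∀ ℓ₀ : ℝ, 0 < ℓ₀ → ∀ W : Family a ℓ₀, (∀ᶠ k in atTop, AdmAt κ η a L β' ℓ₀ W k) →
    ∀ (φ : ℕ → ℕ) (c m : YMSpecies SU3 → ℕ → ℝ) (T : OSData (YMSpecies SU3) 4) (Δ : ℝ),
      StrictMono φ → ClauseConv a L ha ha₀ haL β' ℓ₀ W φ c m T → T.IsNontrivial r₃.curvature →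
      0 < Δ → ClauseCluster a L β' ℓ₀ W Δ →
      ClauseLipOff κ η a L ha ha₀ haL β' ℓ₀ W c m → ClauseLip κ η a L ha ha₀ haL β' ℓ₀ W c m

/-- **The ultraviolet regime** (statement of `stub_uvRider`; FOREIGN to this line — it is the crux
restricted to block scales `ℓ₀ < c/Λ'`, for every `c > 0`, i.e. the territory of the rider
(card soft-absorption-balaban-cone: soft conditioning into Bałaban's analytic format and the RG-level
item #2′; triage r1-3 scope line (3)): the `(ℓ/ℓ₀)⁴` wall is real — below `c₁/Λ'` cone members shift
the infrared scale and no bounded-density argument reaches the certificate scale). Stated with its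
own `(η₄, κ₄)`; the composition reconciles the constants by monotonicity. It inherits the (iv) flag. -/
def UVRider : Prop :=
  ∀ c : ℝ, 0 < c → ∃ η₄ : ℝ, 0 < η₄ ∧ ∃ κ₄ : ℝ, 0 ≤ κ₄ ∧
    ∀ (a : ℕ → ℝ) (L : ℕ → ℕ) (ha : ∀ k, 0 < a k) (ha₀ : Tendsto a atTop (𝓝 0))
      (haL : Tendsto (fun k => a k * L k) atTop atTop) (β' : ℕ → ℝ) (Λ' : ℝ), 0 < Λ' →
      Tendsto (fun k => β' k - afBeta 0 Λ' (a k)) atTop (𝓝 0) →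
    ∀ ℓ₀ : ℝ, 0 < ℓ₀ → Λ' * ℓ₀ < c →
    ∀ W : Family a ℓ₀, (∀ᶠ k in atTop, AdmAt κ₄ (budget η₄ Λ' ℓ₀) a L β' ℓ₀ W k) →
      Concl κ₄ (budget η₄ Λ' ℓ₀) a L ha ha₀ haL β' ℓ₀ W

end Legs

/-! ## §5 The registered stubs -/

/-- **stub_localAC** — THE LEVER (provable now; size M). (a) ratio of integrals with
`w/w' ∈ e^{-c}[e^{-δ|R|}, e^{δ|R|}]` (polymers missing `R` have edge support disjoint from `Λ`, D1
`dependsOn`; `Σ_{X∋y}‖(W-W')_X‖ ≤ weightedSum ≤ δ` for `κ ≥ 0`); (b) the same with the two exterior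
data: polymers through `R` that see a differing link contain a far corner, hence `≥ m+2` blocks by (h4),
weight `≤ η e^{-κ(m+2)}` per block of `R` (D1 `supNorm_mul_exp_le_of_normLE`); Wilson plaquettes touching
`Λ` have all links `1`-near `R`; (c) `Measure.tilted` of the glued product Haar is a probability
(bounded continuous density, `ρ` continuous, second countability), properness/consistency of tilted
product kernels, and `perturbedMeasure = Z⁻¹ e^{-βS-W}∏dHaar` is DLR (disintegration of product Haar;
Georgii2011 Def. 1.23/2.9, Prop. 2.5). The refuter-landed global case of (a) is
`abs_total_sub_total_le`; ideator-2's `local_oscillation`/`conditional_expectation_sandwich` are (a) at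
`W' = 0`. Sources: Georgii2011 ch. 1–2, FriedliVelenik2017 Thm 5.4, Balaban1988Convergent (2.42). -/
theorem stub_localAC : LocalACToolkit := by
  sorry

/-- **stub_mixingEngine** — THE ENGINE (classical probability; size L/XL; `G`-blind; believed).
Disagreement percolation (BergMaes1994; DobrushinShlosman1985 `C_V` in TV form; Weitz2005 /
DyerEtAl2004 combinatorial form) run ON THE TORUS for `cov_ν(f,g)` through the tilt
`ν ↦ g̃ν/ν(g̃)` (Georgii2011 §8.2, tree `abs_covariance_le_of_isKRContraction` is the one-site
template), exploring cells outward from `Δg` so that every kernel met is `γ_U(·|explored)`: a cell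
transmits disagreement with probability `≤ ε` when the explored data around it are GOOD (good-exterior
condition of `γ`, obtained inside the proof from that of `γ₀` by local a.c.:
`ε = ε₀ + 2(e^{ε₁(4n+1)⁴} − 1)`), with probability `≤ 1` when some cube/shell cell is BAD or when the
conditional badness of an unexplored shell cell exceeds `√p` ("bad-heavy", `ν`-rare by Markov's
inequality), and jumps distance `D` with probability `≤ Λl e^{-rD}` (leak; Kerimov-type long-range
disagreement percolation, doi:10.1088/1742-5468/2014/10/p10014); bad cells are Peierls-rare under `ν₀`
by hypothesis and under `ν` by the simultaneous bootstrap "ratio mixing of `μ_{tW}` ⇒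
`d/dt log μ_{tW}(E) ≤ Cε₁` ⇒ rarity under `μ_{tW}`" along `t ∈ [0,1]` (the local-perturbation
principle; BertiniCirilloOlivieri1999 and doi:10.1007/s10955-006-9214-8 are the bounded-spin
precedent: graded cluster expansion around a strongly mixing reference with rare bad regions).
Subcriticality: `ε·shellCount n + c(n)(√p + Λl/r⁴) < 1`. WHY IT MIGHT FAIL: the bootstrap for
rarity under the PERTURBED measure may need mixing of CONDITIONED measures (selection bias of the
adaptive exploration), which Peierls for bad cells does not give; then the engine needs Peierls under
`ν` as an extra hypothesis and the line needs a global tool for it (chessboard is unavailable on prime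
tori `2S+1`). Sources: DobrushinShlosman1985, DobrushinShlosman1987, BergMaes1994, Martinelli1999,
Weitz2005, DyerEtAl2004, BertiniCirilloOlivieri1999, Georgii2011 §8. -/
theorem stub_mixingEngine : PerturbedMixingEngine := by
  sorry

/-- **stub_wilsonCertificate** — THE BET (YM-hard, open; W-free; the card's Transfer target `C⁺` in
good-exterior form = OneCertifiedCube.CrossoverCertificate in ∀-a.f.-sequence, typical-boundary
form + HeavyThreshold #6 `YMLatticeGapAlongAFSequences` in certificate form). Honours Disproof §5
(`robustYangMills_imp_wilson`: the crux contains the pure-Wilson gap along EVERY a.f. sequence — this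
stub is where that content enters the IR half) and §4 (`robustYangMillsNoSmall_false`: (h3) is used
quantitatively downstream, in `stub_deployment`, through `ε₁ = 2·7⁴·η₁`). WHY IT MIGHT BE FALSE: (1) no
`k`-uniform good-exterior TV bound exists because even TYPICAL exterior data influence the central
cell's lattice-scale σ-algebra through UV modes (the free-field proxy says no: typical boundary shifts
have `O(1)·c_n` Cameron–Martin norm, `k`-uniformly — triage r1-2's transfer-matrix heuristic; r1-1's
kit job j009795 tests the WORST case only); (2) the SU(3) Wilson theory along some a.f. sequence is not
in a massive phase at scale `c₁/Λ'` (the crux itself); (3) Peierls-rarity of coherent-flux cells fails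
`k`-uniformly (it should improve with `k`: cost `≍ β θ² (ℓ/a_k)²`). Cheapest falsifier: the GFF/compact
`U(1)` toy of the GOOD-exterior influence vs `b` (kit), which must stay bounded as `b → ∞`.
Sources: DobrushinShlosman1985, DobrushinKolafaShlosman1985, Kennedy1993, HallerKennedy1996,
Balaban1989LargeFieldII, JaffeWitten2000 §5, Luscher1986, arXiv:hep-lat/0204023. -/
theorem stub_wilsonCertificate : WilsonGoodCertificate := by
  sorry

/-- **stub_deployment** — glue with content (provable now modulo its inputs; size M/L): frames of scale
`⌈2ℓ₀/a_k⌉` with `≥ 4n+3` cells per axis on `ℤ/(2S+1)` (`ZMod` combinatorics, as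
LatticeGapOnTrajectory's `stub_torusFrames`), blocks-per-cell and cells-per-block counting (`7⁴`, `2⁴`),
the toolkit ⇒ engine hypotheses for `(wilsonSpec, spec W)` with `ν₀ = wilsonMeasure = perturbedMeasure 0`
(D1 `perturbedMeasure_zero`) and `ν = perturbedMeasure W`, species supports inside `≤ 2⁴` cells,
`τ_t` ⇒ cell distance `≥ t/(4⌈2ℓ₀/a_k⌉) − 2`, ceil arithmetic `⌈2ℓ₀/a_k⌉ ≤ 3ℓ₀/a_k` eventually, and the
`∀ᶠ` bookkeeping (`a_k L_k → ∞`, tree `SpeciesScheme.tendsto_L`-style). Output constants: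
`η₁(κ) = min(ε₁, log(1+Λ₀))/(2·4·(4n+1)⁴·7⁴)`, `Δ = κₑ/(12ℓ₀)`. Sources: Georgii2011 Rem. 1.24,
OsterwalderSeiler1978 §2, SeilerLNP1982 ch. 2. -/
theorem stub_deployment : Deployment := by
  sorry

/-- **stub_renormalisedLeg** — the renormalised-field clauses (i′), (ii), gap, (iv) on `⁰𝒮` (YM-hard;
contains the `W ≡ 0` Clay core by Disproof §5, the washing input of the rigidity lines, E1 and the gap
transfer — see `RenormalisedLeg`). Not this line's mechanism; filed so that the skeleton concludes the
crux by name and so that the lead can swap in the companion lines' items (cross-plane-hankel-rigidity: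
`YMCore`, `SchwingerWashing`, `OffDiagonalResponse`; OneCertifiedCube `ContinuumLimitExists` /
`GapToContinuum`; ParabolicTrajectory `ContinuumLimitOnTrajectory`). Local a.c. enters through the
transfer of boundary-GOOD-uniform UV bounds and of conditional-variance / third-cumulant margins from
Wilson (the card's U-half). WHY IT MIGHT FAIL: an admissible, non-washed (CLT-normalised) block functional
would make the `c_k ≍ a_k^{-4}`-renormalised two-point function of `μ_{β',W}` diverge (crux false at
(i′)/(ii)); E1 for hypercubic-but-not-`O(4)` cone members is open. Sources: JaffeWitten2000,
Balaban1988Convergent, Balaban1989LargeFieldII, MagnenRivasseauSeneor1993, OsterwalderSchrader1975,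
OsterwalderSeilerAnnPhys1978, GlimmJaffe1987 §6.1/§19, Seiler1982 ch. 2, FriedliVelenik2017 ch. 5,
doi:10.1007/s10955-006-9214-8. -/
theorem stub_renormalisedLeg : RenormalisedLeg := by
  sorry

/-- **stub_diagonalExtension** — SUSPECT shared node (see `DiagonalExtension`): (iv) on `⁰𝒮` ⇒ verbatim
(iv). Believed FALSE as the crux stands (coincident third moments: `3Δμ·Var ≍ δ g_k² a_k^{-4}`); TRUE and
size S–M once (iv) is restated on `⁰𝒮` or on truncated functions. Filed to name the defect, not to be
staffed. Sources: triage r1-2 App. C; Lines/cross-plane-hankel-rigidity.lean §2 Stub 5. -/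
theorem stub_diagonalExtension : DiagonalExtension := by
  sorry

/-- **stub_uvRider** — the ultraviolet regime `Λ'ℓ₀ < c` (FOREIGN: the crux restricted to small block
scales; delivered, if at all, by the soft-absorption line — card soft-absorption-balaban-cone, its
Transfer `RobustYangMillsRG♭`, ParabolicTrajectory.ParabolicCentreCurve — not by local absolute
continuity; recorded here as the honest second leg of the regime split `ℓ₀ ≷ c₁/Λ'`, triage r1-2/r1-3
scope lines). If that line dies, THIS line covers exactly the IR regime. Sources: Balaban1988Convergent,
Balaban1989LargeFieldII, JaffeWitten2000. -/
theorem stub_uvRider : UVRider := by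
  sorry

/-! ### Name-keyed aliases of the seven statements (hypotheses of the composition)

`Registered.stub_X` is statement `X` under the registered stub's short name, so that the native skeleton
audit (hypotheses admissible iff registered obligations / declared stubs BY NAME) accepts
`RobustYangMills_of : Registered.stub_localAC → … → RobustYangMills` (device of
Lines/cross-plane-hankel-rigidity.lean, Cruxes/NoisyFourier/Lines/half-conserved-witness.lean). -/
namespace Registered

/-- Alias of `LocalACToolkit` keyed by the registered stub name. -/
abbrev stub_localAC : Prop := LocalACToolkit
/-- Alias of `PerturbedMixingEngine` keyed by the registered stub name. -/
abbrev stub_mixingEngine : Prop := PerturbedMixingEngine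
/-- Alias of `WilsonGoodCertificate` keyed by the registered stub name. -/
abbrev stub_wilsonCertificate : Prop := WilsonGoodCertificate
/-- Alias of `Deployment` keyed by the registered stub name. -/
abbrev stub_deployment : Prop := Deployment
/-- Alias of `RenormalisedLeg` keyed by the registered stub name. -/
abbrev stub_renormalisedLeg : Prop := RenormalisedLeg
/-- Alias of `DiagonalExtension` keyed by the registered stub name. -/
abbrev stub_diagonalExtension : Prop := DiagonalExtension
/-- Alias of `UVRider` keyed by the registered stub name. -/
abbrev stub_uvRider : Prop := UVRider

end Registered

/-! ## §6 Monotonicity of the crux's clauses in `(κ, η, Δ)` -/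

section Mono

variable {κ κ' η η' : ℝ} {a : ℕ → ℝ} {L : ℕ → ℕ} {β' : ℕ → ℝ} {ℓ₀ : ℝ}

theorem budget_nonneg {η₀ Λ' ℓ₀ : ℝ} (h : 0 ≤ η₀) : 0 ≤ budget η₀ Λ' ℓ₀ :=
  div_nonneg h (le_trans zero_le_one (le_max_left _ _))

theorem budget_le {η₀ Λ' ℓ₀ : ℝ} (h : 0 ≤ η₀) : budget η₀ Λ' ℓ₀ ≤ η₀ :=
  div_le_self h (le_max_left _ _)

theorem budget_mono {η₀ η₀' Λ' ℓ₀ : ℝ} (h : η₀ ≤ η₀') : budget η₀ Λ' ℓ₀ ≤ budget η₀' Λ' ℓ₀ :=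
  div_le_div_of_nonneg_right h (le_trans zero_le_one (le_max_left _ _))

/-- Admissibility is antitone in `κ` and monotone in `η` (only (h3) moves). -/
theorem AdmAt.mono {W : Family a ℓ₀} {k : ℕ} (h : AdmAt κ η a L β' ℓ₀ W k) (hκ : κ' ≤ κ)
    (hη : η ≤ η') : AdmAt κ' η' a L β' ℓ₀ W k := fun S hS =>
  ⟨(h S hS).1, (h S hS).2.1, (h S hS).2.2.1, (h S hS).2.2.2.1,
    ((h S hS).2.2.2.2.1.anti hκ).mono hη, (h S hS).2.2.2.2.2⟩

/-- Clause (iv) with a LARGER admissible set of comparison families implies it with a smaller one. -/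
theorem ClauseLip.mono {ha : ∀ k, 0 < a k} {ha₀ : Tendsto a atTop (𝓝 0)}
    {haL : Tendsto (fun k => a k * L k) atTop atTop} {W : Family a ℓ₀}
    {c m : YMSpecies SU3 → ℕ → ℝ} (h : ClauseLip κ' η' a L ha ha₀ haL β' ℓ₀ W c m) (hκ : κ' ≤ κ)
    (hη : η ≤ η') : ClauseLip κ η a L ha ha₀ haL β' ℓ₀ W c m := by
  intro n σ f
  obtain ⟨C, hC⟩ := h n σ f
  refine ⟨C, hC.mono fun k hk W' hW' δ hδ hN => ?_⟩
  exact hk W' (hW'.mono hκ hη) δ hδ fun S hS => (hN S hS).anti hκ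

/-- The conclusion is antitone in `κ` and monotone in `η`. -/
theorem Concl.mono {ha : ∀ k, 0 < a k} {ha₀ : Tendsto a atTop (𝓝 0)}
    {haL : Tendsto (fun k => a k * L k) atTop atTop} {W : Family a ℓ₀}
    (h : Concl κ' η' a L ha ha₀ haL β' ℓ₀ W) (hκ : κ' ≤ κ) (hη : η ≤ η') :
    Concl κ η a L ha ha₀ haL β' ℓ₀ W := by
  obtain ⟨φ, hφ, c, m, T, Δ, hΔ, h1, h2, h3, h4, h5, h6⟩ := h
  exact ⟨φ, hφ, c, m, T, Δ, hΔ, h1, h2, h3, h4, h5, h6.mono hκ hη⟩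

/-- Clause (iii′) is antitone in the rate. -/
theorem ClauseCluster.anti {W : Family a ℓ₀} {Δ Δ' : ℝ} (ha : ∀ k, 0 < a k)
    (h : ClauseCluster a L β' ℓ₀ W Δ) (hΔ : Δ' ≤ Δ) : ClauseCluster a L β' ℓ₀ W Δ' := by
  intro A B
  obtain ⟨C, hC⟩ := h A B
  refine ⟨max C 0, hC.mono fun k hk S hS n hn => (hk S hS n hn).trans ?_⟩
  have hx : 0 ≤ a k * n := mul_nonneg (ha k).le (Nat.cast_nonneg n)
  calc C * Real.exp (-(Δ * (a k * n)))
      ≤ max C 0 * Real.exp (-(Δ * (a k * n))) :=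
        mul_le_mul_of_nonneg_right (le_max_left _ _) (Real.exp_pos _).le
    _ ≤ max C 0 * Real.exp (-(Δ' * (a k * n))) :=
        mul_le_mul_of_nonneg_left (Real.exp_le_exp.2 (by nlinarith)) (le_max_right _ _)

/-- The OS mass gap is antitone in the rate. -/
theorem osData_hasMassGap_anti {ι : Type} {d : ℕ} [NeZero d] (T : OSData ι d) {Δ Δ' : ℝ}
    (hΔ' : Δ' ≤ Δ) (h : T.HasMassGap Δ) : T.HasMassGap Δ' := by
  intro n m k k' F G' hF hG
  obtain ⟨C, hC⟩ := h n m k k' F G' hF hG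
  refine ⟨max C 0, fun t ht H hH => (hC t ht H hH).trans ?_⟩
  calc C * Real.exp (-Δ * t) ≤ max C 0 * Real.exp (-Δ * t) :=
        mul_le_mul_of_nonneg_right (le_max_left _ _) (Real.exp_pos _).le
    _ ≤ max C 0 * Real.exp (-Δ' * t) :=
        mul_le_mul_of_nonneg_left (Real.exp_le_exp.2 (by nlinarith)) (le_max_right _ _)

end Mono

/-! ## §7 The composition (kernel-checked; no `sorry` outside the seven stubs) -/

/-- **The line closes the crux BY NAME.** Constants: `c₁` from the deployment (the certificate's IR
scale); `(η₄, κ₄)` from the UV rider at `c = c₁`; `κ := max 1 κ₄`; `η₁(κ)` from the deployment;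
`η₂ ≤ η₁` from the renormalised leg; `η₀ := min η₂ η₄`. Given the crux's data, split on `Λ'ℓ₀ ≷ c₁`.
IR: the budget `η = η₀/max(1, afBeta 0 Λ' ℓ₀) ≤ η₀`, so admissibility at `(κ, η)` feeds the
renormalised leg (subsequence, renormalisations, `T`, (i′), (ii), `Δ_T`, (iv) on `⁰𝒮`) and — through
(h3) ∧ (h4) only — the uniform IR clustering (`Δ_L`, (iii′)); the diagonal extension upgrades (iv);
`Δ := min Δ_L Δ_T` by antitonicity. UV: admissibility at `(κ, η₀)` implies admissibility at `(κ₄, η₄)`,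
the rider concludes, and the conclusion is transported back by `Concl.mono`. -/
theorem RobustYangMills_of (hA : Registered.stub_localAC) (hB : Registered.stub_mixingEngine)
    (hC : Registered.stub_wilsonCertificate) (hD : Registered.stub_deployment)
    (hE : Registered.stub_renormalisedLeg) (hF : Registered.stub_diagonalExtension)
    (hG : Registered.stub_uvRider) : RobustYangMills := by
  obtain ⟨c₁, hc₁, hdep⟩ := hD hA hB hC
  obtain ⟨η₄, hη₄, κ₄, hκ₄, huv⟩ := hG c₁ hc₁
  have hκpos : (0 : ℝ) < max 1 κ₄ := lt_of_lt_of_le one_pos (le_max_left _ _)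
  have hκ₄le : κ₄ ≤ max 1 κ₄ := le_max_right _ _
  obtain ⟨η₁, hη₁, hclu⟩ := hdep (max 1 κ₄) hκpos
  obtain ⟨η₂, hη₂, hη₂₁, hleg⟩ := hE η₁ (max 1 κ₄) c₁ hη₁ hκpos hc₁ hclu
  have hη₀pos : 0 < min η₂ η₄ := lt_min hη₂ hη₄
  have h02 : min η₂ η₄ ≤ η₂ := min_le_left _ _
  have h04 : min η₂ η₄ ≤ η₄ := min_le_right _ _
  refine robustYangMills_of_explicit hη₀pos hκpos.le ?_
  intro a L ha ha₀ haL β' Λ' hΛ' hβ' ℓ₀ hℓ₀ W hW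
  rcases le_or_gt c₁ (Λ' * ℓ₀) with hIR | hUV
  · -- infrared regime: this line
    have hb0 : 0 ≤ budget (min η₂ η₄) Λ' ℓ₀ := budget_nonneg hη₀pos.le
    have hbη₀ : budget (min η₂ η₄) Λ' ℓ₀ ≤ min η₂ η₄ := budget_le hη₀pos.le
    obtain ⟨φ, hφ, c, m, T, hconv, hnt, hng, ⟨ΔT, hΔT, hgapT⟩, hlipOff⟩ :=
      hleg a L ha ha₀ haL β' Λ' hΛ' hβ' ℓ₀ hIR _ hb0 (hbη₀.trans h02) W hW
    obtain ⟨ΔL, hΔL, hcl⟩ := hclu a L ha ha₀ haL β' Λ' hΛ' hβ' ℓ₀ hIR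
    have hcluster : ClauseCluster a L β' ℓ₀ W ΔL := by
      intro A B
      obtain ⟨C, hCk⟩ := hcl A B
      refine ⟨C, ?_⟩
      filter_upwards [hCk, hW] with k hk hWk S hS t ht
      have hcone := hWk S hS
      exact hk S hS (W k S) (hcone.2.2.2.2.1.mono (hbη₀.trans (h02.trans hη₂₁)))
        hcone.2.2.2.2.2 t ht
    have hlip : ClauseLip (max 1 κ₄) (budget (min η₂ η₄) Λ' ℓ₀) a L ha ha₀ haL β' ℓ₀ W c m :=
      hF _ _ a L ha ha₀ haL β' Λ' hΛ' hβ' ℓ₀ hℓ₀ W hW φ c m T ΔL hφ hconv hnt hΔL hcluster hlipOff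
    exact ⟨φ, hφ, c, m, T, min ΔL ΔT, lt_min hΔL hΔT, hconv, hnt, hng,
      osData_hasMassGap_anti T (min_le_right _ _) hgapT,
      hcluster.anti ha (min_le_left _ _), hlip⟩
  · -- ultraviolet regime: the rider
    have hW' : ∀ᶠ k in atTop, AdmAt κ₄ (budget η₄ Λ' ℓ₀) a L β' ℓ₀ W k :=
      hW.mono fun k hk => hk.mono hκ₄le (budget_mono h04)
    exact (huv a L ha ha₀ haL β' Λ' hΛ' hβ' ℓ₀ hℓ₀ hUV W hW').mono hκ₄le (budget_mono h04)

/-- **Unconditional form** under the route name of this seat's payload (`NestedDissectionSea`; the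
stubs invoked, `sorry` only inside them). -/
theorem RobustYangMills_proof_nestedDissectionSea : RobustYangMills :=
  RobustYangMills_of stub_localAC stub_mixingEngine stub_wilsonCertificate stub_deployment
    stub_renormalisedLeg stub_diagonalExtension stub_uvRider

/-! ### The shared crux under its other two route names (item stmt-QuantumFields-13897 was filed by
`HeavyThresholdYMBridge`, which the gate treats as primary; the three route copies are verbatim and
definitionally equal, so the same composition serves all three). -/

/-- **The skeleton under the primary name** (the hypothesis-free `<Crux>_proof` the skeleton check
reads; its `sorry`-cone is exactly the seven registered stubs): `HeavyThresholdYMBridge.RobustYangMills`. -/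
theorem RobustYangMills_proof : Summit.QuantumFields.QCD.Theses.HeavyThresholdYMBridge.RobustYangMills :=
  RobustYangMills_of stub_localAC stub_mixingEngine stub_wilsonCertificate stub_deployment
    stub_renormalisedLeg stub_diagonalExtension stub_uvRider

/-- The skeleton under the third name, `AdaptiveBlockFermions.RobustYangMills`. -/
theorem RobustYangMills_proof_adaptiveBlockFermions :
    Summit.QuantumFields.QCD.Theses.AdaptiveBlockFermions.RobustYangMills :=
  RobustYangMills_of stub_localAC stub_mixingEngine stub_wilsonCertificate stub_deployment
    stub_renormalisedLeg stub_diagonalExtension stub_uvRider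

/-- Composition concluding the PRIMARY copy `HeavyThresholdYMBridge.RobustYangMills` (sorry-free). -/
theorem RobustYangMills_of_primary (hA : Registered.stub_localAC) (hB : Registered.stub_mixingEngine)
    (hC : Registered.stub_wilsonCertificate) (hD : Registered.stub_deployment)
    (hE : Registered.stub_renormalisedLeg) (hF : Registered.stub_diagonalExtension)
    (hG : Registered.stub_uvRider) : Summit.QuantumFields.QCD.Theses.HeavyThresholdYMBridge.RobustYangMills :=
  RobustYangMills_of hA hB hC hD hE hF hG

/-- Composition concluding the copy `AdaptiveBlockFermions.RobustYangMills` (sorry-free). -/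
theorem RobustYangMills_of_adaptiveBlockFermions (hA : Registered.stub_localAC) (hB : Registered.stub_mixingEngine)
    (hC : Registered.stub_wilsonCertificate) (hD : Registered.stub_deployment)
    (hE : Registered.stub_renormalisedLeg) (hF : Registered.stub_diagonalExtension)
    (hG : Registered.stub_uvRider) : Summit.QuantumFields.QCD.Theses.AdaptiveBlockFermions.RobustYangMills :=
  RobustYangMills_of hA hB hC hD hE hF hG

end Summit.QuantumFields.QCD.Cruxes.RobustYangMills.LocalAcOpenCertificate

end
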